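import Summits.BirchSwinnertonDyer.BirchSwinnertonDyer.Theorems.PublishedInputsGreenbergCasselsRelaxedIndexOdd
import Summits.BirchSwinnertonDyer.BirchSwinnertonDyer.Theorems.PublishedInputsGreenbergCasselsLocImageTorsion
import Literature.NumberTheory.EllipticCurves.PAdicBSDKatoFiniteProofs
import HarnessLib

set_option linter.dupNamespace false -- `…BirchSwinnertonDyer.BirchSwinnertonDyer…` is the cell's nested layout (D-0017)
set_option autoImplicit false

/-!
# CASSELS' COKERNEL WITH RATIONAL `p`-TORSION, COUNTED: `[H¹_{𝓛, ⊤ at 𝔮}(K, E[p^k]) : Sel_{p^k}(E/K)] · #E(K)(p) = #E(K_𝔮)[p^k]`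
# at a finite place `𝔮 ∤ p`, ODD `p`, deep level, `Sel_{p^∞}(E/K)` finite — every number field (Greenberg LNM 1716 Prop. 4.13)

Seat `bsd-inputs-k4-p1` (gen 7; LADDER-BSD D-0154 KEY (147)(f) «prove the printed input», row 1 K4 INPUTS; Greenberg
1999), `--supports stmt-BirchSwinnertonDyer-20309`. THEOREMS ONLY (no definition, no named fact, no `sorry`).

R. Greenberg, LNM 1716 (1999), §4 p. 104: "a theorem of Cassels which states that `𝒫_E^Σ(F)/𝒢_E^Σ(F) ≅ E(F)_p^∧`"; Appendix
Prop. 4.13 (pp. 121–122): the cokernel of `H¹(F_Σ/F, M) → ∏_{v∈Σ} H¹(F_v, M)/L_v` is dual to `S_{M^*}(F)^∧ = E(F)_p` (p. 122: «if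
`S_{M^*}(F)` is finite … `S_{M^*}(F) = E(F)_p`»). The tree had this only for `E(F)[p] = 0` (surjectivity,
`InputsPoitouTateSelmer.casselsSurjectivity_H1Sigma_holds`). With the two previous files of this seat (E1 the exact relaxation index
`[KO : Sel] · #loc_𝔮 Sel = #𝓛_𝔮` for odd `p`, any `K`; E2 `loc_𝔮 Sel_N = loc_𝔮 κ_N(E(K))` at `𝔮 ∤ p`, deep `N`) this file COUNTS
the cokernel at finite level, with rational `p`-torsion ALLOWED:

* §1 `natCard_map_localization_ker_torsionH1ToH1` — for `E(K)` finite, `𝔮 ∤ p` and `n = p^k`, `k ≥ a` (the local torsion exponent: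
  `p^a` kills `E(K_𝔮)[p^∞]`): **`#loc_𝔮 κ_n(E(K)) = #E(K)(p)`** (`= #primaryComponent E(K) p`). The prime-to-`p` part of `E(K)` is
  `n`-divisible, hence has trivial local Kummer image (Bézout); on the `p`-primary part `P ↦ κ_{n,𝔮}(P)` is injective
  (`κ_{n,𝔮}(P) = 0 ⇒ P = nR` in `E(K_𝔮)`, `R` is `p`-power torsion, `p^a R = 0`, `a ≤ k`).
* §2 **`exists_relIndex_selmerGroup_kummerOutside_mul_natCard_primaryComponent_eq`** — MAIN: `K` any number field, `p` ODD,
  `𝔮 ∤ p` finite, `Sel_{p^∞}(E/K)` finite: ∃ `k₁`, ∀ `k ≥ k₁`,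
  **`[kummerOutside W (p^k) {𝔮} : Sel_{p^k}(E/K)] · #E(K)(p) = #E(K_𝔮)[p^k] · #(𝓞_𝔮/p^k)`** (and `#(𝓞_𝔮/p^k) = 1`,
  `natCard_quot_adicCompletionIntegers_eq_one`): E1 × (level transport `(p^k) = (p^e)(p^{k₀})`, `natCard_map_localization_selmerGroup_congr`)
  × E2 × §1 × `finite_point_of_finite_selmerGroupPInfty` (Mordell–Weil + `Sel` finite ⇒ `E(K)` finite).
  Since `#H¹(K_𝔮, E[p^k]) = #𝓛_𝔮²` (Tate), the image of `H¹_{𝓛, ⊤ at 𝔮}(K, E[p^k])` in `H¹(K_𝔮, E[p^k])/𝓛_𝔮 = H¹(K_𝔮, E)[p^k]` has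
  index exactly `#E(K)(p)` — Cassels' cokernel `E(F)_p^∧` at the place `𝔮`, finite level, torsion allowed.
HONEST FRAMING: finite level and a single auxiliary place `𝔮 ∤ p` (the `p^∞` / all-of-`Σ` translation via this seat's
`casselsSurjectivity_H1Sigma_eraseOne` is the sequel); `p = 2` not treated (E1); closes no item by itself; no summit statement is
proved; BSD is not proved by any of this.
References: [GreenbergLNM1716] §4 p. 104, Prop. 4.13 (pp. 121–123); [SilvermanAEC2009] VIII §2, X §4, VII.6.3; [MilneADT2006] I §6,
Lemma 6.15; [Cassels1964ArithmeticVII].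
-/

noncomputable section

open scoped Classical NumberField

open Function NumberField IsDedekindDomain WeierstrassCurve
open Literature.NumberTheory.EllipticCurves Literature.NumberTheory.GaloisRepresentations

namespace Summit.BirchSwinnertonDyer.BirchSwinnertonDyer.Theorems.InputsGreenbergCasselsTorsion

variable {K : Type} [Field K] [NumberField K] (W : WeierstrassCurve K) [W.IsElliptic] (p : ℕ) [hp : Fact p.Prime]
  (𝔮 : HeightOneSpectrum (𝓞 K))

/-! ## §1 `#loc_𝔮 κ_n(E(K)) = #E(K)(p)` for `E(K)` finite, `n = p^k` deep -/

omit [NumberField K] [W.IsElliptic] hp in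
/-- Bézout: an element killed by `c` with `c` prime to `n` is an `n`-multiple. [folklore] -/
theorem exists_zsmul_eq_of_nsmul_eq_zero_of_coprime {A : Type*} [AddCommGroup A] {c n : ℕ} (hcn : Nat.Coprime c n) {P : A}
    (hP : c • P = 0) : ∃ Q : A, (n : ℤ) • Q = P := by
  have hbez := Nat.gcd_eq_gcd_ab c n
  rw [Nat.Coprime.gcd_eq_one hcn, Nat.cast_one] at hbez
  refine ⟨Nat.gcdB c n • P, ?_⟩
  have hc : (c : ℤ) • P = 0 := by rw [natCast_zsmul, hP]
  calc (n : ℤ) • Nat.gcdB c n • P = ((n : ℤ) * Nat.gcdB c n) • P + Nat.gcdA c n • ((c : ℤ) • P) := by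
        rw [hc, smul_zero, add_zero, smul_smul]
    _ = P := by rw [smul_smul, ← add_smul, mul_comm (Nat.gcdA c n), add_comm, ← hbez, one_smul]

/-- **`#loc_𝔮 κ_n(E(K)) = #E(K)(p)`** (`E(K)` finite, `𝔮` a finite place with `p^a E(K_𝔮)[p^∞] = 0`, `n = p^k`, `k ≥ a`): the local
image at `𝔮` of the kernel of `H¹(K, E[n]) → H¹(K, E)` (= the Kummer classes of `E(K)`) has the order of the `p`-primary part of
`E(K)`. [cite: GreenbergLNM1716, §4 Appendix Prop. 4.13 (p. 122, «S_{M^*}(F) = E(F)_p»)] [cite: SilvermanAEC2009, VIII §2, X §4] -/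
theorem natCard_map_localization_ker_torsionH1ToH1 [Finite W.toAffine.Point] (a : ℕ)
    (ha : ∀ T : (W.baseChange (𝔮.adicCompletion K)).toAffine.Point, (∃ j : ℕ, p ^ j • T = 0) → p ^ a • T = 0)
    (k : ℕ) (hk : a ≤ k) {n : ℤ} (hn : n = ((p ^ k : ℕ) : ℤ)) :
    Nat.card (((torsionH1ToH1 W n).ker).map (galoisCohomology.localization (W.torsionGaloisModule n) (Sum.inr 𝔮) 1)) =
      Nat.card (AddCommGroup.primaryComponent W.toAffine.Point p) := by
  subst hn
  have hprime : p.Prime := hp.out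
  have hn0 : ((p ^ k : ℕ) : ℤ) ≠ 0 := by exact_mod_cast pow_ne_zero k hprime.ne_zero
  haveI : CharZero (𝔮.adicCompletion K) := charZero_of_injective_algebraMap (algebraMap K (𝔮.adicCompletion K)).injective
  have hdiv := W.zsmul_geomPoints_surjective_of_charZero hn0
  -- the map `f = κ_{n,𝔮} ∘ (E(K) → E(K_𝔮))`
  set b : W.toAffine.Point →+ (W.baseChange (𝔮.adicCompletion K)).toAffine.Point :=
    Affine.Point.baseChange (W' := W) K (𝔮.adicCompletion K) with hb
  have hbinj : Injective b := Affine.Point.map_injective _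
  set f : W.toAffine.Point →+ galoisCohomology ((W.torsionGaloisModule ((p ^ k : ℕ) : ℤ)).toLocal (Sum.inr 𝔮)) 1 :=
    (W.localKummerMap (𝔮.adicCompletion K) hn0).comp b with hf
  -- (1) `loc_𝔮(ker) = range f`
  have h1 : ((torsionH1ToH1 W ((p ^ k : ℕ) : ℤ)).ker).map
      (galoisCohomology.localization (W.torsionGaloisModule ((p ^ k : ℕ) : ℤ)) (Sum.inr 𝔮) 1) = f.range := by
    apply le_antisymm
    · rintro _ ⟨x, hx, rfl⟩
      obtain ⟨P, rfl⟩ := W.mem_range_kummerMapTorsion_of_torsionH1ToH1_eq_zero _ hdiv x ((AddMonoidHom.mem_ker).mp hx)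
      exact ⟨P, (localization_kummerMapTorsion_eq_localKummerMap W 𝔮 hn0 hdiv P).symm⟩
    · rintro _ ⟨P, rfl⟩
      exact ⟨kummerMapTorsion W _ hdiv P, (AddMonoidHom.mem_ker).mpr (W.torsionH1ToH1_kummerMapTorsion _ hdiv P),
        localization_kummerMapTorsion_eq_localKummerMap W 𝔮 hn0 hdiv P⟩
  -- (2) `range f = f(E(K)(p))`: the prime-to-`p` part of `E(K)` is `n`-divisible
  set t : ℕ := Nat.card W.toAffine.Point with ht
  have ht0 : t ≠ 0 := Nat.card_pos.ne'
  have htc : p ^ t.factorization p * (t / p ^ t.factorization p) = t := Nat.ordProj_mul_ordCompl_eq_self t p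
  have hcop : Nat.Coprime (t / p ^ t.factorization p) p := (Nat.coprime_ordCompl hprime ht0).symm
  have h2 : f.range = (AddCommGroup.primaryComponent W.toAffine.Point p).map f := by
    refine le_antisymm ?_ (AddSubgroup.map_le_range f _)
    rintro _ ⟨P, rfl⟩
    -- Bézout `α p^{a'} + β c' = 1`: `P = (β c') P + (α p^{a'}) P`
    have hbez := Nat.gcd_eq_gcd_ab (p ^ t.factorization p) (t / p ^ t.factorization p)
    rw [Nat.Coprime.gcd_eq_one (hcop.symm.pow_left _), Nat.cast_one] at hbez
    set P₁ : W.toAffine.Point := ((t / p ^ t.factorization p : ℕ) * Nat.gcdB (p ^ t.factorization p) (t / p ^ t.factorization p)) • P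
    set P₂ : W.toAffine.Point := ((p ^ t.factorization p : ℕ) * Nat.gcdA (p ^ t.factorization p) (t / p ^ t.factorization p)) • P
    have hsum : P = P₁ + P₂ := by
      rw [← add_smul, add_comm, ← hbez, one_smul]
    have htP : t • P = 0 := card_nsmul_eq_zero'
    have key : ∀ z : ℤ, ((t : ℤ) * z) • P = 0 := fun z ↦ by
      rw [mul_comm, mul_smul, natCast_zsmul, htP, smul_zero]
    have hP₁ : P₁ ∈ AddCommGroup.primaryComponent W.toAffine.Point p := by
      refine (AddCommGroup.mem_primaryComponent).mpr ⟨t.factorization p, ?_⟩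
      change p ^ t.factorization p • (((t / p ^ t.factorization p : ℕ) *
        Nat.gcdB (p ^ t.factorization p) (t / p ^ t.factorization p) : ℤ) • P) = 0
      rw [← natCast_zsmul, smul_smul, ← mul_assoc, ← Nat.cast_mul, htc]
      exact key _
    have hP₂ : (t / p ^ t.factorization p) • P₂ = 0 := by
      change (t / p ^ t.factorization p) • (((p ^ t.factorization p : ℕ) *
        Nat.gcdA (p ^ t.factorization p) (t / p ^ t.factorization p) : ℤ) • P) = 0
      rw [← natCast_zsmul, smul_smul, ← mul_assoc, ← Nat.cast_mul, mul_comm (t / _), htc]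
      exact key _
    obtain ⟨Q, hQ⟩ := exists_zsmul_eq_of_nsmul_eq_zero_of_coprime (n := p ^ k) (hcop.pow_right k) hP₂
    have hfP₂ : f P₂ = 0 := by
      have : b P₂ ∈ (W.localKummerMap (𝔮.adicCompletion K) hn0).ker := by
        rw [W.ker_localKummerMap (𝔮.adicCompletion K) hn0]
        exact ⟨b Q, by rw [zsmulAddGroupHom_apply, ← map_zsmul, hQ]⟩
      exact (AddMonoidHom.mem_ker).mp this
    refine ⟨P₁, hP₁, ?_⟩
    rw [hsum, map_add, hfP₂, add_zero]
  -- (3) `f` is injective on `E(K)(p)`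
  have h3 : Set.InjOn f (AddCommGroup.primaryComponent W.toAffine.Point p : Set W.toAffine.Point) := by
    intro P hP P' hP' hPP'
    rw [← sub_eq_zero] at hPP' ⊢
    rw [← map_sub] at hPP'
    have hmem : P - P' ∈ AddCommGroup.primaryComponent W.toAffine.Point p := sub_mem hP hP'
    obtain ⟨i, hi⟩ := (AddCommGroup.mem_primaryComponent).mp hmem
    have hker : b (P - P') ∈ (W.localKummerMap (𝔮.adicCompletion K) hn0).ker := (AddMonoidHom.mem_ker).mpr hPP'
    rw [W.ker_localKummerMap (𝔮.adicCompletion K) hn0] at hker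
    obtain ⟨R, hR⟩ := hker
    rw [zsmulAddGroupHom_apply, natCast_zsmul] at hR
    -- `R` is `p`-power torsion, so `p^a R = 0` and `p^k R = 0`
    have hRtors : p ^ (k + i) • R = 0 := by
      rw [pow_add, mul_comm, mul_smul, hR, ← map_nsmul, hi, map_zero]
    have hR0 : p ^ k • R = 0 := by
      rw [show k = (k - a) + a by omega, pow_add, mul_smul, ha R ⟨k + i, hRtors⟩, smul_zero]
    apply hbinj
    rw [← hR, hR0, map_zero]
  -- (4) count
  rw [h1, h2]
  have hcoe : ((AddCommGroup.primaryComponent W.toAffine.Point p).map f : Set _) =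
      f '' (AddCommGroup.primaryComponent W.toAffine.Point p : Set W.toAffine.Point) := AddSubgroup.coe_map f _
  calc Nat.card ((AddCommGroup.primaryComponent W.toAffine.Point p).map f)
      = Nat.card (f '' (AddCommGroup.primaryComponent W.toAffine.Point p : Set W.toAffine.Point)) :=
        Nat.card_congr (Equiv.setCongr hcoe)
    _ = Nat.card (AddCommGroup.primaryComponent W.toAffine.Point p : Set W.toAffine.Point) := Nat.card_image_of_injOn h3
    _ = Nat.card (AddCommGroup.primaryComponent W.toAffine.Point p) := rfl

/-! ## §2 The count -/

omit [W.IsElliptic] hp in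
/-- Level transport: the order of `loc_𝔮 Sel_n(E/K)` depends only on the integer `n`. [folklore] -/
theorem natCard_map_localization_selmerGroup_congr {n₁ n₂ : ℤ} (h : n₁ = n₂) :
    Nat.card ((W.selmerGroup n₁).map (galoisCohomology.localization (W.torsionGaloisModule n₁) (Sum.inr 𝔮) 1)) =
      Nat.card ((W.selmerGroup n₂).map (galoisCohomology.localization (W.torsionGaloisModule n₂) (Sum.inr 𝔮) 1)) := by
  subst h; rfl

omit [W.IsElliptic] hp in
/-- At a finite place `𝔮 ∤ p`, `#(𝓞_𝔮/p^k) = 1` (`p` is a unit of `𝓞_𝔮`). [folklore] -/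
theorem natCard_quot_adicCompletionIntegers_eq_one (h𝔮 : ((p : ℕ) : 𝓞 K) ∉ 𝔮.asIdeal) (k : ℕ) :
    Nat.card (𝔮.adicCompletionIntegers K ⧸ Ideal.span {((p ^ k : ℕ) : 𝔮.adicCompletionIntegers K)}) = 1 := by
  have hnot : ((p ^ k : ℕ) : 𝓞 K) ∉ 𝔮.asIdeal := by
    rw [Nat.cast_pow]
    exact fun h ↦ h𝔮 (𝔮.isPrime.mem_of_pow_mem k h)
  have hunit : IsUnit ((p ^ k : ℕ) : 𝔮.adicCompletionIntegers K) := by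
    have h := IsDedekindDomain.HeightOneSpectrum.isUnit_algebraMap_adicCompletionIntegers K 𝔮 hnot
    rwa [map_natCast] at h
  haveI : Subsingleton (𝔮.adicCompletionIntegers K ⧸ Ideal.span {((p ^ k : ℕ) : 𝔮.adicCompletionIntegers K)}) :=
    Ideal.Quotient.subsingleton_iff.mpr (Ideal.span_singleton_eq_top.mpr hunit)
  exact Nat.card_of_subsingleton (0 : 𝔮.adicCompletionIntegers K ⧸ Ideal.span {((p ^ k : ℕ) : 𝔮.adicCompletionIntegers K)})

/-- **CASSELS' COKERNEL WITH RATIONAL `p`-TORSION, COUNTED (Greenberg Prop. 4.13 at finite level).** For `E = W` elliptic over ANY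
number field `K`, an ODD prime `p`, a finite place `𝔮 ∤ p`, and `Sel_{p^∞}(E/K)` finite, there is `k₁` such that for every `k ≥ k₁`
`[kummerOutside W (p^k) {𝔮} : Sel_{p^k}(E/K)] · #E(K)(p) = #E(K_𝔮)[p^k] · #(𝓞_𝔮/p^k)`
(the relaxed-at-`𝔮` Selmer group has index `#𝓛_𝔮 / #E(K)(p)` over the Selmer group; equivalently the image of
`H¹_{𝓛, ⊤ at 𝔮}(K, E[p^k]) → H¹(K_𝔮, E)[p^k]` has index `#E(K)(p)`). No hypothesis on `E(K)[p]`.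
[cite: GreenbergLNM1716, §4 p. 104 and Appendix Prop. 4.13 (pp. 121–122)] [cite: MilneADT2006, Ch. I, Thm. 4.10 (b), Lemma 6.15] -/
theorem exists_relIndex_selmerGroup_kummerOutside_mul_natCard_primaryComponent_eq (hodd : Odd p)
    (h𝔮 : ((p : ℕ) : 𝓞 K) ∉ 𝔮.asIdeal) [Finite (W.selmerGroupPInfty p)] :
    ∃ k₁ : ℕ, ∀ k : ℕ, k₁ ≤ k →
      (W.selmerGroup ((p ^ k : ℕ) : ℤ)).relIndex (kummerOutside W (p ^ k) {Sum.inr 𝔮}) *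
          Nat.card (AddCommGroup.primaryComponent W.toAffine.Point p) =
        Nat.card (nsmulAddMonoidHom (p ^ k) : (W.baseChange (𝔮.adicCompletion K)).toAffine.Point →+ _).ker *
          Nat.card (𝔮.adicCompletionIntegers K ⧸ Ideal.span {((p ^ k : ℕ) : 𝔮.adicCompletionIntegers K)}) := by
  have hprime : p.Prime := hp.out
  haveI : Finite W.toAffine.Point := W.finite_point_of_finite_selmerGroupPInfty p
  obtain ⟨e, a, hE2⟩ := exists_map_localization_selmerGroup_eq_map_ker W p 𝔮 h𝔮
  obtain ⟨a', -, ha'⟩ := exists_pow_divisible_point_adicCompletion W p 𝔮 h𝔮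
  refine ⟨e + a + a' + 1, fun k hk ↦ ?_⟩
  have hk0 : 0 < k := by omega
  have hlev : ((p ^ k : ℕ) : ℤ) = ((p ^ e : ℕ) : ℤ) * ((p ^ (k - e) : ℕ) : ℤ) := by
    rw [← Nat.cast_mul, ← pow_add, show e + (k - e) = k by omega]
  have hcount : Nat.card ((W.selmerGroup ((p ^ k : ℕ) : ℤ)).map
      (galoisCohomology.localization (W.torsionGaloisModule ((p ^ k : ℕ) : ℤ)) (Sum.inr 𝔮) 1)) =
      Nat.card (AddCommGroup.primaryComponent W.toAffine.Point p) := by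
    rw [natCard_map_localization_selmerGroup_congr W 𝔮 hlev, hE2 (k - e) (by omega)]
    exact natCard_map_localization_ker_torsionH1ToH1 W p 𝔮 a' ha' k (by omega) hlev.symm
  rw [← hcount]
  exact relIndex_selmerGroup_kummerOutside_mul_natCard_map_eq_odd W p k hodd hk0 𝔮

/-- **The same with `#(𝓞_𝔮/p^k) = 1` evaluated: `[kummerOutside W (p^k) {𝔮} : Sel_{p^k}(E/K)] · #E(K)(p) = #E(K_𝔮)[p^k]`.**
[cite: GreenbergLNM1716, §4 p. 104 and Appendix Prop. 4.13 (pp. 121–122)] -/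
theorem exists_relIndex_selmerGroup_kummerOutside_mul_natCard_primaryComponent_eq_natCard_torsion (hodd : Odd p)
    (h𝔮 : ((p : ℕ) : 𝓞 K) ∉ 𝔮.asIdeal) [Finite (W.selmerGroupPInfty p)] :
    ∃ k₁ : ℕ, ∀ k : ℕ, k₁ ≤ k →
      (W.selmerGroup ((p ^ k : ℕ) : ℤ)).relIndex (kummerOutside W (p ^ k) {Sum.inr 𝔮}) *
          Nat.card (AddCommGroup.primaryComponent W.toAffine.Point p) =
        Nat.card (nsmulAddMonoidHom (p ^ k) : (W.baseChange (𝔮.adicCompletion K)).toAffine.Point →+ _).ker := by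
  obtain ⟨k₁, h⟩ := exists_relIndex_selmerGroup_kummerOutside_mul_natCard_primaryComponent_eq W p 𝔮 hodd h𝔮
  refine ⟨k₁, fun k hk ↦ ?_⟩
  rw [h k hk, natCard_quot_adicCompletionIntegers_eq_one p 𝔮 h𝔮 k, mul_one]

end Summit.BirchSwinnertonDyer.BirchSwinnertonDyer.Theorems.InputsGreenbergCasselsTorsion

end
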